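import Mathlib.Analysis.SpecialFunctions.Pow.Real
import Mathlib.Analysis.SpecialFunctions.Log.Basic
import Mathlib.Analysis.SpecialFunctions.Sqrt
import Mathlib.Analysis.Real.Pi.Bounds
import Mathlib.Analysis.SpecialFunctions.Exp
import Mathlib.Analysis.Complex.ExponentialBounds
import Literature.NumberTheory.Sieve.SelbergSymmetryFormula
import Literature.NumberTheory.LFunctions.LittlewoodOscillationInputsAverageProofs
import HarnessLib

/-!
# Route IntegerScrew — arithmetic of the fine blocks of the tail (no zeros, no `ζ`)

Helper file for crux `IntegerScrew.ScrewPolyFloor` (stmt-RiemannHypothesis-15757), TailFloor: the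
real-number inequalities that make one fine block `(V, V(1+1/K)]`, `K = 2560 M²`, `V ≥ M¹⁶`, of the
expansion of the screw form positive with margin `log V/(128 K V)` (`block_arith`), given the RH-free
window margin (constant `C_P`) and the Riemann–von Mangoldt count (constant `C_U`), for
`M ≥ max(3, 327680 C_P, 5120 C_U)`; and `(1 + 1/K)^k ≤ 3` for `k ≤ K` (the tree's
`LittlewoodAverage.log_two_pi_le_two` and `SelbergSymmetry.log_sq_le_sqrt` supply `log 2π ≤ 2`,
`log² x ≤ 16 √x`).
-/

noncomputable section

open Real

-- the layout-mandated namespace repeats the summit name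
set_option linter.dupNamespace false

namespace Summit.RiemannHypothesis.RiemannHypothesis.Theorems.IntegerScrewLandau

/-- `(1 + 1/K)^k ≤ 3` for `k ≤ K` (`≤ e`). [folklore] -/
theorem one_add_inv_pow_le_three {K k : ℕ} (hK : 1 ≤ K) (hk : k ≤ K) :
    (1 + 1 / (K : ℝ)) ^ k ≤ 3 := by
  have hK0 : (0 : ℝ) < K := by exact_mod_cast hK
  have h1 : (1 : ℝ) ≤ 1 + 1 / K := by
    have : (0 : ℝ) ≤ 1 / K := by positivity
    linarith
  calc (1 + 1 / (K : ℝ)) ^ k ≤ (1 + 1 / (K : ℝ)) ^ K := pow_le_pow_right₀ h1 hk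
    _ ≤ (Real.exp (1 / K)) ^ K := by
        gcongr
        linarith [Real.add_one_le_exp (1 / (K : ℝ))]
    _ = Real.exp 1 := by
        rw [← Real.exp_nat_mul, mul_one_div_cancel hK0.ne']
    _ ≤ 3 := by linarith [Real.exp_one_lt_d9]

set_option maxHeartbeats 800000 in
/-- **The arithmetic of one fine block.** With `K = 2560 M²`, `V ≥ M¹⁶`, `W = V(1 + 1/K)`,
`M ≥ 3`, `log M ≥ 1`, `327680 C_P ≤ M`, `5120 C_U ≤ M`, and a block count
`ΔN ≤ 2(((W−V)/2π) log(W/2π) + C_U log W)`: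
`log V/(128 K V) ≤ [((W−V)/π)(log(V/2π) − log M − 1) − C_P(log W + M⁵ log²W)]/W² − M² ΔN ((W²−V²)/(V²W²) + 2/V³)`.
[folklore] -/
theorem block_arith {CP CU Mr V K ΔN : ℝ} (hCP : 0 ≤ CP)
    (hM3 : 3 ≤ Mr) (hlogM : 1 ≤ Real.log Mr) (hK : K = 2560 * Mr ^ 2) (hV : Mr ^ 16 ≤ V)
    (hC1 : 327680 * CP ≤ Mr) (hC2 : 5120 * CU ≤ Mr)
    (hΔN : ΔN ≤ 2 * ((V * (1 + 1 / K) - V) / (2 * π) * Real.log (V * (1 + 1 / K) / (2 * π)) +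
      CU * Real.log (V * (1 + 1 / K)))) :
    Real.log V / (128 * K * V) ≤
      ((V * (1 + 1 / K) - V) / π * (Real.log (V / (2 * π)) - Real.log Mr - 1) -
          CP * (Real.log (V * (1 + 1 / K)) + Mr ^ 5 * Real.log (V * (1 + 1 / K)) ^ 2)) /
          (V * (1 + 1 / K)) ^ 2 -
        Mr ^ 2 * ΔN * (((V * (1 + 1 / K)) ^ 2 - V ^ 2) / (V ^ 2 * (V * (1 + 1 / K)) ^ 2) + 2 / V ^ 3) := by
  -- basic sizes
  have hM0 : 0 < Mr := by linarith
  have hM1 : 1 ≤ Mr := by linarith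
  have hK0 : 0 < K := by rw [hK]; positivity
  have hKge : 2560 ≤ K := by rw [hK]; nlinarith
  have hM16 : Mr ^ 16 = (Mr ^ 8) ^ 2 := by ring
  have hM8 : 1 ≤ Mr ^ 8 := one_le_pow₀ hM1
  have hV1 : 1 ≤ V := le_trans (by nlinarith) hV
  have hV0 : 0 < V := by linarith
  set W : ℝ := V * (1 + 1 / K) with hW
  have hWV : W - V = V / K := by rw [hW]; field_simp; ring
  have hVK0 : 0 ≤ V / K := by positivity
  have hVW : V ≤ W := by linarith
  have hW2 : W ≤ 2 * V := by
    have : V / K ≤ V := div_le_self hV0.le (by linarith)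
    linarith
  have hW0 : 0 < W := by linarith
  -- `V ≥ K`, `V ≥ 2`, `√V ≥ M⁸`
  have hM14 : K ≤ Mr ^ 16 := by
    rw [hK]
    have h3 : (2560 : ℝ) ≤ Mr ^ 14 := by
      calc (2560 : ℝ) ≤ 3 ^ 14 := by norm_num
        _ ≤ Mr ^ 14 := pow_le_pow_left₀ (by norm_num) hM3 14
    nlinarith
  have hKV : K ≤ V := hM14.trans hV
  have hV2 : 2 ≤ V := le_trans (by linarith) hKV
  have hsqrtV : Mr ^ 8 ≤ Real.sqrt V := by
    rw [Real.le_sqrt' (by positivity), ← hM16]; exact hV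
  -- logarithms
  have hlogV : 16 * Real.log Mr ≤ Real.log V := by
    have e : Real.log (Mr ^ 16) = 16 * Real.log Mr := by
      rw [Real.log_pow]; norm_num
    rw [← e]; exact Real.log_le_log (by positivity) hV
  have hlogV16 : 16 ≤ Real.log V := le_trans (by linarith) hlogV
  have hlogV0 : 0 ≤ Real.log V := by linarith
  have hlogW : Real.log W ≤ 2 * Real.log V := by
    have hWV2 : W ≤ V ^ 2 := by nlinarith
    calc Real.log W ≤ Real.log (V ^ 2) := Real.log_le_log hW0 hWV2
      _ = 2 * Real.log V := by rw [Real.log_pow]; norm_num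
  have hlogW1 : 1 ≤ Real.log W := by
    have := Real.log_le_log hV0 hVW
    linarith
  have hlogW0 : 0 ≤ Real.log W := by linarith
  -- (m1) `log(V/2π) − log M − 1 ≥ log V / 2`
  have hA : Real.log V / 2 ≤ Real.log (V / (2 * π)) - Real.log Mr - 1 := by
    rw [Real.log_div hV0.ne' (by positivity)]
    have := Literature.NumberTheory.LFunctions.LittlewoodAverage.log_two_pi_le_two
    linarith
  have hA0 : 0 ≤ Real.log (V / (2 * π)) - Real.log Mr - 1 := le_trans (by linarith) hA
  -- (m2) first part of the margin
  have hm2 : V * Real.log V / (8 * K) ≤ (W - V) / π * (Real.log (V / (2 * π)) - Real.log Mr - 1) := by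
    rw [hWV]
    have hπ4 : π ≤ 4 := Real.pi_le_four
    have hπ0 : 0 < π := Real.pi_pos
    calc V * Real.log V / (8 * K) = V / (4 * K) * (Real.log V / 2) := by field_simp; ring
      _ ≤ V / K / π * (Real.log V / 2) := by
          refine mul_le_mul_of_nonneg_right ?_ (by linarith)
          rw [div_div]
          refine div_le_div_of_nonneg_left hV0.le (by positivity) ?_
          calc K * π ≤ K * 4 := mul_le_mul_of_nonneg_left hπ4 hK0.le
            _ = 4 * K := by ring
      _ ≤ V / K / π * (Real.log (V / (2 * π)) - Real.log Mr - 1) :=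
          mul_le_mul_of_nonneg_left hA (by positivity)
  -- (m3) the junk of the margin
  have hjunk : CP * (Real.log W + Mr ^ 5 * Real.log W ^ 2) ≤ V * Real.log V / (16 * K) := by
    have hM5 : 1 ≤ Mr ^ 5 := one_le_pow₀ hM1
    have h1 : Real.log W ≤ Mr ^ 5 * Real.log W ^ 2 := by
      calc Real.log W = 1 * (Real.log W * 1) := by ring
        _ ≤ Mr ^ 5 * (Real.log W * Real.log W) := by gcongr
        _ = Mr ^ 5 * Real.log W ^ 2 := by ring
    have h2 : Real.log W ^ 2 ≤ 4 * Real.log V ^ 2 := by nlinarith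
    have h3 : Real.log V ^ 2 ≤ 16 * Real.sqrt V := Literature.NumberTheory.Sieve.SelbergSymmetry.log_sq_le_sqrt hV1
    have h4 : CP * (Real.log W + Mr ^ 5 * Real.log W ^ 2) ≤ 128 * CP * Mr ^ 5 * Real.sqrt V := by
      calc CP * (Real.log W + Mr ^ 5 * Real.log W ^ 2) ≤ CP * (2 * (Mr ^ 5 * Real.log W ^ 2)) :=
            mul_le_mul_of_nonneg_left (by linarith) hCP
        _ ≤ CP * (2 * (Mr ^ 5 * (4 * (16 * Real.sqrt V)))) := by gcongr; exact h2.trans (by linarith)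
        _ = 128 * CP * Mr ^ 5 * Real.sqrt V := by ring
    refine h4.trans ?_
    -- `128 CP M⁵ √V ≤ V log V/(16 K)`  ⟸  `327680 CP ≤ M`, `√V ≥ M⁸`, `log V ≥ 16`
    rw [hK, le_div_iff₀ (by positivity)]
    have hsq : Real.sqrt V * Real.sqrt V = V := Real.mul_self_sqrt hV0.le
    have e1 : 128 * CP * Mr ^ 5 * Real.sqrt V * (16 * (2560 * Mr ^ 2)) =
        16 * (327680 * CP) * Mr ^ 7 * Real.sqrt V := by ring
    rw [e1]
    calc 16 * (327680 * CP) * Mr ^ 7 * Real.sqrt V ≤ 16 * Mr * Mr ^ 7 * Real.sqrt V := by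
          gcongr
      _ = 16 * Mr ^ 8 * Real.sqrt V := by ring
      _ ≤ Real.log V * Real.sqrt V * Real.sqrt V := by
          refine mul_le_mul_of_nonneg_right ?_ (Real.sqrt_nonneg _)
          exact mul_le_mul hlogV16 hsqrtV (by positivity) hlogV0
      _ = V * Real.log V := by rw [mul_assoc, hsq]; ring
  -- the margin
  have hmargin : V * Real.log V / (16 * K) ≤
      (W - V) / π * (Real.log (V / (2 * π)) - Real.log Mr - 1) -
        CP * (Real.log W + Mr ^ 5 * Real.log W ^ 2) := by
    have : V * Real.log V / (8 * K) = V * Real.log V / (16 * K) + V * Real.log V / (16 * K) := by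
      field_simp; ring
    linarith
  have hmarginW : Real.log V / (64 * K * V) ≤
      ((W - V) / π * (Real.log (V / (2 * π)) - Real.log Mr - 1) -
        CP * (Real.log W + Mr ^ 5 * Real.log W ^ 2)) / W ^ 2 := by
    rw [le_div_iff₀ (by positivity)]
    calc Real.log V / (64 * K * V) * W ^ 2 ≤ Real.log V / (64 * K * V) * (2 * V) ^ 2 := by
          gcongr
      _ = V * Real.log V / (16 * K) := by field_simp; ring
      _ ≤ _ := hmargin
  -- the count in the block
  have hΔN' : ΔN ≤ 4 * V * Real.log V / K := by
    have hlogW2π : Real.log (W / (2 * π)) ≤ Real.log W :=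
      Real.log_le_log (by positivity) (div_le_self hW0.le (by linarith [Real.pi_gt_three]))
    have h1 : (W - V) / (2 * π) * Real.log (W / (2 * π)) ≤ V / K / 2 * Real.log W := by
      rw [hWV]
      calc V / K / (2 * π) * Real.log (W / (2 * π)) ≤ V / K / (2 * π) * Real.log W :=
            mul_le_mul_of_nonneg_left hlogW2π (by positivity)
        _ ≤ V / K / 2 * Real.log W := by
            refine mul_le_mul_of_nonneg_right ?_ hlogW0
            refine div_le_div_of_nonneg_left (by positivity) (by norm_num) ?_
            linarith [Real.pi_gt_three]
    have h2 : 2 * CU ≤ V / K := by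
      rw [le_div_iff₀ hK0, hK]
      calc 2 * CU * (2560 * Mr ^ 2) = (5120 * CU) * Mr ^ 2 := by ring
        _ ≤ Mr * Mr ^ 2 := by gcongr
        _ = Mr ^ 3 := by ring
        _ ≤ Mr ^ 16 := pow_le_pow_right₀ hM1 (by norm_num)
        _ ≤ V := hV
    calc ΔN ≤ 2 * ((W - V) / (2 * π) * Real.log (W / (2 * π)) + CU * Real.log W) := hΔN
      _ ≤ 2 * (V / K / 2 * Real.log W + CU * Real.log W) := by linarith
      _ = (V / K + 2 * CU) * Real.log W := by ring
      _ ≤ (V / K + V / K) * (2 * Real.log V) :=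
          mul_le_mul (by linarith) hlogW hlogW0 (by positivity)
      _ = 4 * V * Real.log V / K := by ring
  -- the weights
  have hweights : (W ^ 2 - V ^ 2) / (V ^ 2 * W ^ 2) + 2 / V ^ 3 ≤ 5 / (K * V ^ 2) := by
    have h1 : (W ^ 2 - V ^ 2) / (V ^ 2 * W ^ 2) ≤ 3 / (K * V ^ 2) := by
      rw [div_le_div_iff₀ (by positivity) (by positivity)]
      have e : W ^ 2 - V ^ 2 = V / K * (W + V) := by rw [← hWV]; ring
      rw [e]
      have hWV3 : W + V ≤ 3 * V := by linarith
      have hV2W2 : V ^ 2 ≤ W ^ 2 := pow_le_pow_left₀ hV0.le hVW 2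
      calc V / K * (W + V) * (K * V ^ 2) = V ^ 3 * (W + V) := by field_simp
        _ ≤ V ^ 3 * (3 * V) := by gcongr
        _ = 3 * (V ^ 2 * V ^ 2) := by ring
        _ ≤ 3 * (V ^ 2 * W ^ 2) := by gcongr
    have h2 : 2 / V ^ 3 ≤ 2 / (K * V ^ 2) :=
      div_le_div_of_nonneg_left (by norm_num) (by positivity) (by nlinarith)
    have e : 5 / (K * V ^ 2) = 3 / (K * V ^ 2) + 2 / (K * V ^ 2) := by ring
    linarith
  -- the error
  have herr : Mr ^ 2 * ΔN * ((W ^ 2 - V ^ 2) / (V ^ 2 * W ^ 2) + 2 / V ^ 3) ≤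
      Real.log V / (128 * K * V) := by
    have hw0 : 0 ≤ (W ^ 2 - V ^ 2) / (V ^ 2 * W ^ 2) + 2 / V ^ 3 := by
      have : 0 ≤ W ^ 2 - V ^ 2 := by nlinarith
      positivity
    have e : Mr ^ 2 * (4 * V * Real.log V / K) * (5 / (K * V ^ 2)) = Real.log V / (128 * K * V) := by
      rw [hK]
      field_simp
      ring
    calc Mr ^ 2 * ΔN * ((W ^ 2 - V ^ 2) / (V ^ 2 * W ^ 2) + 2 / V ^ 3)
        ≤ Mr ^ 2 * (4 * V * Real.log V / K) * (5 / (K * V ^ 2)) :=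
          mul_le_mul (mul_le_mul_of_nonneg_left hΔN' (by positivity)) hweights hw0 (by positivity)
      _ = Real.log V / (128 * K * V) := e
  -- conclusion
  have e64 : Real.log V / (64 * K * V) = Real.log V / (128 * K * V) + Real.log V / (128 * K * V) := by
    field_simp; ring
  linarith

end Summit.RiemannHypothesis.RiemannHypothesis.Theorems.IntegerScrewLandau

end
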